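import Literature.MathematicalPhysics.QuantumFieldTheory.ONVectorCertificate
import Literature.MathematicalPhysics.QuantumFieldTheory.ONVectorNonVacuity
import HarnessLib

/-!
# Non-vacuity of the typed `O(N)` vector datum (`ONVectorCertificate.VectorDatum`): the generalised free
# `O(N)` vector field is a `VectorDatum N`, so `VectorExcluded N A Q` never holds at a free point its gaps admit

Topic `MathematicalPhysics/QuantumFieldTheory`; one definition + theorems (no named fact, no instance, no
`sorry`, no new axiom).  The companion of `ONVectorCertificate.lean` [KosPolandSimmonsduffin2014ON] at the
level of its bundled AXIOMS, exactly as `ConformalBootstrap3D/DecoupledPairNonVacuity.lean` is the companion of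
the `σ–ε` axioms: `ONVectorNonVacuity.lean` shows that no three-component POINT FUNCTIONAL on a spectrum containing
the generalised free solution excludes it; this file packages that solution as a bona fide `VectorDatum N` — index
types, dimensions, spins, non-negative squared OPE coefficients, ADMISSIBLE channel functions (`IsChannelBlockUV`:
pull-backs to the diamond of typed 3D blocks), convergent channel expansions and crossing at every diamond point —
and reads off the set-level consequence for the claim shape `VectorExcluded N A Q` of a certificate: whenever the
run's gaps admit the free point (`Δ_S^*, Δ_T^* ≤ 2p`), `p ∉ Q` (§3); equivalently a certified singlet (resp.
symmetric-tensor) gap at an admitted `Δ_φ = p` is `> 2p` — every excluded region lies strictly above the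
generalised free line.  The one new analytic input is elementary (§1): the typed Hogervorst–Rychkov block is
symmetric under `z ↔ z̄` (`hrMonomialCoeff_symm` of the tree), so the `(u,v)`-form block `blockUV` of
`ONVectorNonVacuity` IS the pull-back of the typed block (`pullbackOnDiamond_blockUV`, `isChannelBlockUV_blockUV`).
Honest framing: this file is bookkeeping over published material (the system, assumptions and claim shape of
[KosPolandSimmonsduffin2014ON, §2.1–2.2, §4.1], the generalised free `O(N)` correlator of [HenrikssonVanLoon2018,
§2], the generalised-free decompositions of [FitzpatrickKaplan2012, §2.2] in the blocks of [HogervorstRychkov2013,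
§2.1] as formalised under `ConformalBootstrap3D/` and in `ONVectorNonVacuity.lean`); it serves shared numerical
engines whose rigour lives in their verifiers, and every published number belongs to a client cell's ledger, not
to this file — no bound or exclusion plot is asserted or touched here.

SOURCES (held texts `paper:arxiv-1307.6856` = [KosPolandSimmonsduffin2014ON], `paper:arxiv-1801.03512` =
[HenrikssonVanLoon2018]; the quotations are the ones carried verbatim by `ONVectorSumRule.lean`,
`ONVectorCertificate.lean` and `ONVectorNonVacuity.lean`):
* [KosPolandSimmonsduffin2014ON, §2.1–2.2]: the `O(N)` vector four-point function, its three channel sums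
  `G_S ∋ 1, G_T, G_A` (even, even, odd spins), the crossing equation / vector sum rule, and the logic of a run:
  assume gaps (§4.1: a singlet gap `Δ_S^*` with `Δ_T^* = 1`, or a symmetric-tensor gap), find a functional, "the
  assumption is ruled out" — the tree's `VectorDatum`, `VectorGaps`, `VectorExcluded`.
* [HenrikssonVanLoon2018, §2]: the generalised free `O(N)` vector field: `𝒢^{(0)}_S = 1 + (u^{Δφ}/N)(1 + v^{−Δφ})`,
  `𝒢^{(0)}_{T,A}` (in the tree's normalisation `gffT = ½(u^p + (u/v)^p)`, `gffA = ½((u/v)^p − u^p)`), its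
  generalised free OPE coefficients, crossing for every `N` — `ONVectorNonVacuity.gffS/gffT/gffA`, `crossingAt_gff`,
  `hasSum_gffS/T/A` (double twists `[φφ]_{n,ℓ}`, even `ℓ` in `S, T`, odd `ℓ` in `A`).
* [FitzpatrickKaplan2012, §2.2] via `ConformalBootstrap3D/MeanField*.lean`: `P_{n,ℓ}(p) ≥ 0` for `p > 1/2`
  (`mftCoeff_nonneg`), unitarity of the double-twist points (`gff_unitarity`, `unitarityBound3D_lt_twist`).
* [HogervorstRychkov2013, §2.1 eq. (2.16)] via `ConformalBootstrap3D/BlockExistence.lean`,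
  `BlockCoefficientExistence.lean`: `g^{HR}_{Δ,ℓ}(z,z̄) = (z z̄)^{(Δ−ℓ)/2} Σ k_{mn} z^m z̄^n` with a symmetric array
  (`hrMonomialCoeff_symm`), a genuine block above the unitarity bound (`IsAdmissible3D.isConformalBlock3D_hrBlock`).

CONTENTS.  §1 `hrSeries_comm_args`, `hrBlock_comm_args`, `pullbackOnDiamond_blockUV`, `isChannelBlockUV_blockUV`.
§2 `gffVec N hp : VectorDatum N` (`p > 1/2`; the thirty-odd fields discharged by the imported lemmas) and its gaps
`gffVec_satisfiesGaps[_of_le]` (`Δ_S^*, Δ_T^* ≤ 2p`).  §3 `not_mem_of_vectorExcluded`, `not_vectorExcluded_of_mem`,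
`lt_gapS_of_vectorExcluded` / `lt_gapT_of_vectorExcluded` (a certified gap at an admitted point exceeds `2p`), the
source's run shapes `lt_gapS_of_vectorExcluded_one` (`Δ_T^* = 1`), `lt_gapT_of_vectorExcluded_one` (`Δ_S^* = 1`),
and `not_mem_of_vectorExcluded_half` (unitarity alone excludes nothing).

LIMITS.  Nothing here evaluates a block numerically, asserts a bound, or touches a certificate; `N = 0, 1` are
admitted as junk/degenerate instances of the same algebra (the free datum solves crossing identically in `N`),
with no physical claim; interacting data are the clients' business.
-/

noncomputable section

namespace Literature.MathematicalPhysics.QuantumFieldTheory.ONVectorDatumNonVacuity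

open Set
open Literature.MathematicalPhysics.QuantumFieldTheory.ConformalBootstrap3D
open Literature.MathematicalPhysics.QuantumFieldTheory.ONVectorCertificate
open Literature.MathematicalPhysics.QuantumFieldTheory.ONVectorNonVacuity

/-! ## §1 The typed block is symmetric under `z ↔ z̄`, so the `(u,v)`-form block pulls back to it -/

section Blocks

/-- The Hogervorst–Rychkov double power series `K_{Δ,ℓ}(z, z̄)` is symmetric under `z ↔ z̄` (its coefficient
array is, `hrMonomialCoeff_symm`). [cite: HogervorstRychkov2013, §2.1 eq. (2.16)] -/
theorem hrSeries_comm_args (Δ : ℝ) (ℓ : ℕ) (z zb : ℝ) : hrSeries Δ ℓ zb z = hrSeries Δ ℓ z zb := by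
  unfold hrSeries
  rw [← (Equiv.prodComm ℕ ℕ).tsum_eq (fun p : ℕ × ℕ => hrMonomialCoeff Δ ℓ p * z ^ p.1 * zb ^ p.2)]
  refine tsum_congr fun p => ?_
  obtain ⟨m, n⟩ := p
  simp only [Equiv.prodComm_apply, Prod.swap_prod_mk]
  rw [hrMonomialCoeff_symm Δ ℓ (m, n)]
  ring

/-- The typed block `g^{HR}_{Δ,ℓ}(z, z̄)` is symmetric under `z ↔ z̄`. [cite: HogervorstRychkov2013, §2.1 eq. (2.16)] -/
theorem hrBlock_comm_args (Δ : ℝ) (ℓ : ℕ) (z zb : ℝ) : hrBlock Δ ℓ zb z = hrBlock Δ ℓ z zb := by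
  unfold hrBlock
  rw [mul_comm zb z, hrSeries_comm_args]

/-- The `(u,v)`-form block `blockUV Δ ℓ` of `ONVectorNonVacuity` is the pull-back to the diamond of the typed
block: the roots `zOfUV, zbOfUV` of `u = z z̄`, `v = (1−z)(1−z̄)` recover `{min, max}(z, z̄)` and the block is
symmetric. [cite: KosPolandSimmonsduffin2014ON, §2.2] [cite: HogervorstRychkov2013, §2.1 eq. (2.16)] -/
theorem pullbackOnDiamond_blockUV (Δ : ℝ) (ℓ : ℕ) : PullbackOnDiamond (blockUV Δ ℓ) (hrBlock Δ ℓ) := by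
  intro z zb _ _
  simp only [blockUV]
  rw [zOfUV_eq_min, zbOfUV_eq_max]
  rcases le_total z zb with h | h
  · rw [min_eq_left h, max_eq_right h]
  · rw [min_eq_right h, max_eq_left h, hrBlock_comm_args]

/-- **`blockUV Δ ℓ` is an admissible channel function** (`IsChannelBlockUV`) at every point strictly above
the unitarity bound. [cite: KosPolandSimmonsduffin2014ON, §2.1] [cite: HogervorstRychkov2013, §2.1 eq. (2.16)] -/
theorem isChannelBlockUV_blockUV {Δ : ℝ} {ℓ : ℕ} (h : unitarityBound3D ℓ < Δ) :
    IsChannelBlockUV Δ ℓ (blockUV Δ ℓ) :=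
  ⟨hrBlock Δ ℓ, (isAdmissible3D_of_lt h).isConformalBlock3D_hrBlock, pullbackOnDiamond_blockUV Δ ℓ⟩

end Blocks

/-! ## §2 The datum -/

section Datum

variable (N : ℕ) {p : ℝ}

/-- **The generalised free `O(N)` vector datum** `gffVec N hp : VectorDatum N` (`Δ_φ = p > 1/2`): in each
sector the double-twist family `[φφ]_{n,ℓ}` at `(2p+2n+ℓ, ℓ)` — even `ℓ = 2m` in `S⁺` with `λ² = 2P_{n,2m}(p)/N`
and in `T⁺` with `λ² = P_{n,2m}(p)`, odd `ℓ = 2m+1` in `A⁻` with `λ² = P_{n,2m+1}(p)` — with the `(u,v)`-form typed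
blocks `blockUV`, the channel sums `𝒢_S = gffS N p` (unit included), `𝒢_T = gffT p`, `𝒢_A = gffA p` of
`ONVectorNonVacuity`, their convergent expansions at every diamond point (`hasSum_gffS/T/A`) and crossing
(`crossingAt_gff`, every `N`). [cite: KosPolandSimmonsduffin2014ON, §2.1]
[cite: HenrikssonVanLoon2018, §2 (generalized free correlator, 𝒢^{(0)}_S)] [cite: FitzpatrickKaplan2012, §2.2] -/
def gffVec (hp : 1 / 2 < p) : VectorDatum N where
  Δφ := p
  ιS := ℕ × ℕ
  ιT := ℕ × ℕ
  ιA := ℕ × ℕ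
  dimS := fun nm => 2 * p + 2 * nm.1 + 2 * nm.2
  spinS := fun nm => 2 * nm.2
  coefS := fun nm => gffOPECoeffSq p nm / N
  chanS := fun nm => blockUV (2 * p + 2 * nm.1 + 2 * nm.2) (2 * nm.2)
  dimT := fun nm => 2 * p + 2 * nm.1 + 2 * nm.2
  spinT := fun nm => 2 * nm.2
  coefT := fun nm => mftCoeff p nm.1 (2 * nm.2)
  chanT := fun nm => blockUV (2 * p + 2 * nm.1 + 2 * nm.2) (2 * nm.2)
  dimA := fun nm => 2 * p + 2 * (nm.1 : ℝ) + ((2 * nm.2 + 1 : ℕ) : ℝ)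
  spinA := fun nm => 2 * nm.2 + 1
  coefA := fun nm => mftCoeff p nm.1 (2 * nm.2 + 1)
  chanA := fun nm => blockUV (2 * p + 2 * (nm.1 : ℝ) + ((2 * nm.2 + 1 : ℕ) : ℝ)) (2 * nm.2 + 1)
  GS := gffS N p
  GT := gffT p
  GA := gffA p
  coefS_nonneg := fun nm => gffS_weight_nonneg N hp nm
  coefT_nonneg := fun _ => mftCoeff_nonneg hp _ _
  coefA_nonneg := fun _ => mftCoeff_nonneg hp _ _
  spinS_even := fun _ => even_two_mul _
  spinT_even := fun _ => even_two_mul _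
  spinA_odd := fun _ => odd_two_mul_add_one _
  unitaryS := fun nm => (gff_unitarity hp nm.1 nm.2).le
  unitaryT := fun nm => (gff_unitarity hp nm.1 nm.2).le
  unitaryA := fun nm => (unitarityBound3D_lt_twist hp nm.1 (2 * nm.2 + 1)).le
  blockS := fun nm => isChannelBlockUV_blockUV (gff_unitarity hp nm.1 nm.2)
  blockT := fun nm => isChannelBlockUV_blockUV (gff_unitarity hp nm.1 nm.2)
  blockA := fun nm => isChannelBlockUV_blockUV (unitarityBound3D_lt_twist hp nm.1 (2 * nm.2 + 1))
  sumS := fun _ _ hz hzb => hasSum_gffS N hp (inDiamond_of_mem hz hzb)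
  sumT := fun _ _ hz hzb => hasSum_gffT hp (inDiamond_of_mem hz hzb)
  sumA := fun _ _ hz hzb => hasSum_gffA hp (inDiamond_of_mem hz hzb)
  crossing := fun _ _ hz hzb =>
    crossingAt_gff N p (mul_pos hz.1 hzb.1) (mul_pos (by linarith [hz.2]) (by linarith [hzb.2]))

/-- The external dimension of the datum. Plumbing. [folklore] -/
private theorem gffVec_Δφ (hp : 1 / 2 < p) : (gffVec N hp).Δφ = p := rfl

/-- **The gaps the free datum satisfies**: its singlet and traceless-symmetric SCALARS other than the unit are
the `[φφ]_{n,0}` at `2p + 2n ≥ 2p`, so it obeys every `VectorGaps` with `Δ_S^*, Δ_T^* ≤ 2p`.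
[cite: KosPolandSimmonsduffin2014ON, §4.1] [cite: FitzpatrickKaplan2012, §2.2] -/
theorem gffVec_satisfiesGaps_of_le (hp : 1 / 2 < p) {A : VectorGaps} (hS : A.ΔS ≤ 2 * p) (hT : A.ΔT ≤ 2 * p) :
    (gffVec N hp).SatisfiesGaps A := by
  refine ⟨fun nm _ => hS.trans ?_, fun nm _ => hT.trans ?_⟩
  · show 2 * p ≤ 2 * p + 2 * nm.1 + 2 * nm.2
    linarith [Nat.cast_nonneg (α := ℝ) nm.1, Nat.cast_nonneg (α := ℝ) nm.2]
  · show 2 * p ≤ 2 * p + 2 * nm.1 + 2 * nm.2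
    linarith [Nat.cast_nonneg (α := ℝ) nm.1, Nat.cast_nonneg (α := ℝ) nm.2]

/-- In particular against `(2p, 2p)`. [cite: KosPolandSimmonsduffin2014ON, §4.1] -/
theorem gffVec_satisfiesGaps (hp : 1 / 2 < p) : (gffVec N hp).SatisfiesGaps ⟨2 * p, 2 * p⟩ :=
  gffVec_satisfiesGaps_of_le N hp le_rfl le_rfl

end Datum

/-! ## §3 Consequences for the claim shape `VectorExcluded` -/

section Consequences

variable {N : ℕ} {p : ℝ} {A : VectorGaps} {Q : Set ℝ}

/-- **What an excluded set can never contain.**  If `VectorExcluded N A Q` with `Δ_S^*, Δ_T^* ≤ 2p` and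
`p > 1/2`, then `p ∉ Q` — for every `N` (the free datum solves crossing identically in `N`): a certificate
claiming otherwise contradicts the generalised free `O(N)` vector field.
[cite: KosPolandSimmonsduffin2014ON, §2.2] [cite: HenrikssonVanLoon2018, §2 (crossing equation and generalized free correlator)] -/
theorem not_mem_of_vectorExcluded (h : VectorExcluded N A Q) (hp : 1 / 2 < p) (hS : A.ΔS ≤ 2 * p)
    (hT : A.ΔT ≤ 2 * p) : p ∉ Q :=
  fun hQ => h (gffVec N hp) hQ (gffVec_satisfiesGaps_of_le N hp hS hT)

/-- Contrapositive: a set containing an admitted free point is not excluded. [cite: KosPolandSimmonsduffin2014ON, §2.2] -/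
theorem not_vectorExcluded_of_mem (hp : 1 / 2 < p) (hS : A.ΔS ≤ 2 * p) (hT : A.ΔT ≤ 2 * p) (hQ : p ∈ Q) :
    ¬VectorExcluded N A Q :=
  fun h => not_mem_of_vectorExcluded h hp hS hT hQ

/-- **A certified singlet gap at an admitted point exceeds the free value `2Δ_φ`**: `VectorExcluded N A Q`,
`p ∈ Q`, `Δ_T^* ≤ 2p` force `Δ_S^* > 2p` — the excluded region of a singlet-gap scan lies strictly above the
generalised free line `Δ_S = 2Δ_φ`. [cite: KosPolandSimmonsduffin2014ON, §4.1]
[cite: HenrikssonVanLoon2018, §2 (crossing equation and generalized free correlator)] -/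
theorem lt_gapS_of_vectorExcluded (h : VectorExcluded N A Q) (hp : 1 / 2 < p) (hQ : p ∈ Q)
    (hT : A.ΔT ≤ 2 * p) : 2 * p < A.ΔS :=
  lt_of_not_ge fun hS => not_mem_of_vectorExcluded h hp hS hT hQ

/-- Symmetrically for the traceless-symmetric gap. [cite: KosPolandSimmonsduffin2014ON, §4.1] -/
theorem lt_gapT_of_vectorExcluded (h : VectorExcluded N A Q) (hp : 1 / 2 < p) (hQ : p ∈ Q)
    (hS : A.ΔS ≤ 2 * p) : 2 * p < A.ΔT :=
  lt_of_not_ge fun hT => not_mem_of_vectorExcluded h hp hS hT hQ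

/-- **The source's singlet-bound runs** (`Δ_T^* = 1`, i.e. only unitarity-and-a-bit in `T`): whatever singlet
gap `S` such a run certifies on a set containing `p > 1/2`, `S > 2p`. [cite: KosPolandSimmonsduffin2014ON, §4.1] -/
theorem lt_gapS_of_vectorExcluded_one {S : ℝ} (h : VectorExcluded N ⟨S, 1⟩ Q) (hp : 1 / 2 < p) (hQ : p ∈ Q) :
    2 * p < S :=
  lt_gapS_of_vectorExcluded h hp hQ (by show (1 : ℝ) ≤ 2 * p; linarith)

/-- And the symmetric-tensor-bound runs (`Δ_S^* = 1`): a certified `T > 2p` at every admitted `p > 1/2`.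
[cite: KosPolandSimmonsduffin2014ON, §4.1] -/
theorem lt_gapT_of_vectorExcluded_one {T : ℝ} (h : VectorExcluded N ⟨1, T⟩ Q) (hp : 1 / 2 < p) (hQ : p ∈ Q) :
    2 * p < T :=
  lt_gapT_of_vectorExcluded h hp hQ (by show (1 : ℝ) ≤ 2 * p; linarith)

/-- No gap assumption at all (`Δ_S^* = Δ_T^* = 1/2`, unitarity only) excludes nothing above `1/2`.
[cite: KosPolandSimmonsduffin2014ON, §2.2] -/
theorem not_mem_of_vectorExcluded_half (h : VectorExcluded N ⟨1 / 2, 1 / 2⟩ Q) (hp : 1 / 2 < p) : p ∉ Q :=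
  not_mem_of_vectorExcluded h hp (by show (1 / 2 : ℝ) ≤ 2 * p; linarith) (by show (1 / 2 : ℝ) ≤ 2 * p; linarith)

end Consequences

end Literature.MathematicalPhysics.QuantumFieldTheory.ONVectorDatumNonVacuity
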